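import Summits.NavierStokesRegularity.NavierStokesRegularity.Theorems.SelfMixingDichotomyCoherentScaleExclusionStructure

/-!
# Route SelfMixingDichotomy — crux `CoherentScaleExclusion` (S2, item stmt-NavierStokesRegularity-1423):
# the crux implies its cascade regime; modulo S1 the crux IS the cascade stub

Complement to `SelfMixingDichotomyCoherentScaleExclusionStructure`: the statement of the registered stub
`stub_coherentCascadeExclusion` (regime (B) of the birth line: for every `δ > 0`, no final-time point of a
finite-energy classical solution from a rapidly decaying datum has `C(r) → ∞` along all small scales while
non-`δ`-mixing scales recur) FOLLOWS from the crux S2 — in a pure cascade every small scale is `M`-loaded, so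
recurrent non-mixing scales are recurrent `M`-loaded non-mixing scales, S2 gives boundedness, and boundedness caps
the load (`coherentScaleExclusion_loadCeiling_of_bdd`), contradicting the cascade. Together with the route note
`coherentScaleExclusion_of_sequentialTypeIExclusion_of_cascade` (S1 ∧ (B) ⇒ S2) this gives

  `SequentialTypeIExclusion → (CoherentScaleExclusion ↔ (B))`:

modulo the sibling crux S1, which the route's deciding theorem consumes anyway, S2 is EQUIVALENT to its cascade
stub. Pure logic over landed lemmas; for the tenure planner (promote (B) / restate S2 as (B)).
-/

noncomputable section

namespace Summit.NavierStokesRegularity.NavierStokesRegularity.Theorems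

-- single-conjunct summit (`<Problem> = <Summit>`): the duplicated namespace component is by design
set_option linter.dupNamespace false

open MeasureTheory Filter Set Metric
open Literature.Analysis.FluidPDE
open Summit.NavierStokesRegularity.NavierStokesRegularity.Theses.SelfMixingDichotomy

/-- **The crux implies its cascade regime** (registered sub-goal): `CoherentScaleExclusion` ⇒ the statement of
`stub_coherentCascadeExclusion`. Given `δ > 0`, take the threshold `M` of S2; at a point where the load diverges
along all small scales, below the radius `r₁(M)` every scale is `M`-loaded, so the recurrent non-`δ`-mixing
scales are recurrent `M`-loaded non-`δ`-mixing scales; S2 yields boundedness near the point, whence a load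
ceiling (`coherentScaleExclusion_loadCeiling_of_bdd`), which the divergence of the load at threshold `max M₁ 0 + 1`
violates. [folklore] -/
theorem cascadeRegime_of_coherentScaleExclusion :
    Summit.NavierStokesRegularity.NavierStokesRegularity.Theses.SelfMixingDichotomy.CoherentScaleExclusion → ∀ δ : ℝ, 0 < δ → ∀ T : ℝ, 0 < T → ∀ (u : ℝ → EuclideanSpace ℝ (Fin 3) → EuclideanSpace ℝ (Fin 3)) (p : ℝ → EuclideanSpace ℝ (Fin 3) → ℝ), Literature.Analysis.FluidPDE.IsClassicalNSSolutionOn (Set.Ico 0 T) 1 0 u p → Literature.Analysis.FluidPDE.IsLerayHopfOn T 1 0 (u 0) u → Literature.Analysis.FluidPDE.HasRapidSpatialDecay (u 0) → ∀ x₀ : EuclideanSpace ℝ (Fin 3), (∀ M' : ℝ, ∃ r₁ : ℝ, 0 < r₁ ∧ ∀ r ∈ Set.Ioo 0 r₁, ENNReal.ofReal M' ≤ Literature.Analysis.FluidPDE.cknC r ((T, x₀) : ℝ × EuclideanSpace ℝ (Fin 3)) u) → (∀ r₀ : ℝ, 0 < r₀ → ∃ r ∈ Set.Ioo 0 r₀,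 ¬ (∀ θ : ℝ → EuclideanSpace ℝ (Fin 3) → ℝ, Literature.Analysis.FluidPDE.IsSmoothSpaceTimeOn (Set.Icc (T - r ^ 2) (T - r ^ 2 / 2)) θ → Literature.Analysis.FluidPDE.HasUniformRapidDecayOn (Set.Icc (T - r ^ 2) (T - r ^ 2 / 2)) θ → (∀ t ∈ (Set.Icc (T - r ^ 2) (T - r ^ 2 / 2)), ∀ x : EuclideanSpace ℝ (Fin 3), Literature.Analysis.FluidPDE.timeDerivWithin (Set.Icc (T - r ^ 2) (T - r ^ 2 / 2)) θ t x + inner ℝ (u t x) (gradient (θ t) x) = Laplacian.laplacian (θ t) x) → Function.support (θ (T - r ^ 2)) ⊆ Metric.ball x₀ r → ∫ x, (θ (T - r ^ 2 / 2) x) ^ 2 ≤ δ ^ 2 * ∫ x, (θ (T - r ^ 2) x) ^ 2)) → False := by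
  intro hS2 δ hδ T hT u p hcl hLH hdec x₀ hcasc hrec
  obtain ⟨M, hM⟩ := hS2 δ hδ
  -- below `r₁(M)` every scale is `M`-loaded, so the recurrence hypothesis of S2 holds
  obtain ⟨r₁, hr₁, hload⟩ := hcasc M
  have hRec : ∀ r₀ : ℝ, 0 < r₀ → ∃ r ∈ Set.Ioo 0 r₀,
      ENNReal.ofReal M ≤ cknC r ((T, x₀) : ℝ × EuclideanSpace ℝ (Fin 3)) u ∧
      ¬ (∀ θ : ℝ → EuclideanSpace ℝ (Fin 3) → ℝ,
          IsSmoothSpaceTimeOn (Set.Icc (T - r ^ 2) (T - r ^ 2 / 2)) θ →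
          HasUniformRapidDecayOn (Set.Icc (T - r ^ 2) (T - r ^ 2 / 2)) θ →
          (∀ t ∈ (Set.Icc (T - r ^ 2) (T - r ^ 2 / 2)), ∀ x : EuclideanSpace ℝ (Fin 3),
            timeDerivWithin (Set.Icc (T - r ^ 2) (T - r ^ 2 / 2)) θ t x +
              inner ℝ (u t x) (gradient (θ t) x) = Laplacian.laplacian (θ t) x) →
          Function.support (θ (T - r ^ 2)) ⊆ Metric.ball x₀ r →
          ∫ x, (θ (T - r ^ 2 / 2) x) ^ 2 ≤ δ ^ 2 * ∫ x, (θ (T - r ^ 2) x) ^ 2) := by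
    intro r₀ hr₀
    obtain ⟨r, hr, hnot⟩ := hrec (min r₀ r₁) (lt_min hr₀ hr₁)
    exact ⟨r, ⟨hr.1, lt_of_lt_of_le hr.2 (min_le_left _ _)⟩,
      hload r ⟨hr.1, lt_of_lt_of_le hr.2 (min_le_right _ _)⟩, hnot⟩
  have hbdd := hM T hT u p hcl hLH hdec x₀ hRec
  -- boundedness caps the load; the cascade exceeds any cap
  obtain ⟨M₁, ρ₁, hρ₁, hC⟩ := coherentScaleExclusion_loadCeiling_of_bdd hbdd
  obtain ⟨r₂, hr₂, hload₂⟩ := hcasc (max M₁ 0 + 1)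
  have hr : min ρ₁ r₂ / 2 ∈ Set.Ioo 0 (min ρ₁ r₂) :=
    ⟨by positivity, by linarith [lt_min hρ₁ hr₂]⟩
  have h1 := (hC _ ⟨hr.1, lt_of_lt_of_le hr.2 (min_le_left _ _)⟩).trans
    (ENNReal.ofReal_le_ofReal (le_max_left M₁ 0))
  have h2 := hload₂ _ ⟨hr.1, lt_of_lt_of_le hr.2 (min_le_right _ _)⟩
  have h3 : max M₁ 0 + 1 ≤ max M₁ 0 :=
    (ENNReal.ofReal_le_ofReal_iff (le_max_right _ _)).1 (h2.trans h1)
  linarith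

/-- **Modulo S1 the crux IS the cascade stub**: `SequentialTypeIExclusion → (CoherentScaleExclusion ↔ (B))`, with (B)
the statement of `stub_coherentCascadeExclusion` — `→` by `cascadeRegime_of_coherentScaleExclusion` (S1 not needed),
`←` by `coherentScaleExclusion_of_sequentialTypeIExclusion_of_cascade`. [folklore] -/
theorem coherentScaleExclusion_iff_cascadeRegime_of_sequentialTypeIExclusion :
    Summit.NavierStokesRegularity.NavierStokesRegularity.Theses.SelfMixingDichotomy.SequentialTypeIExclusion → (Summit.NavierStokesRegularity.NavierStokesRegularity.Theses.SelfMixingDichotomy.CoherentScaleExclusion ↔ (∀ δ : ℝ, 0 < δ → ∀ T : ℝ, 0 < T → ∀ (u : ℝ → EuclideanSpace ℝ (Fin 3) → EuclideanSpace ℝ (Fin 3)) (p : ℝ → EuclideanSpace ℝ (Fin 3) → ℝ), Literature.Analysis.FluidPDE.IsClassicalNSSolutionOn (Set.Ico 0 T) 1 0 u p → Literature.Analysis.FluidPDE.IsLerayHopfOn T 1 0 (u 0) u → Literature.Analysis.FluidPDE.HasRapidSpatialDecay (u 0) → ∀ x₀ : EuclideanSpace ℝ (Fin 3), (∀ M'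 : ℝ, ∃ r₁ : ℝ, 0 < r₁ ∧ ∀ r ∈ Set.Ioo 0 r₁, ENNReal.ofReal M' ≤ Literature.Analysis.FluidPDE.cknC r ((T, x₀) : ℝ × EuclideanSpace ℝ (Fin 3)) u) → (∀ r₀ : ℝ, 0 < r₀ → ∃ r ∈ Set.Ioo 0 r₀, ¬ (∀ θ : ℝ → EuclideanSpace ℝ (Fin 3) → ℝ, Literature.Analysis.FluidPDE.IsSmoothSpaceTimeOn (Set.Icc (T - r ^ 2) (T - r ^ 2 / 2)) θ → Literature.Analysis.FluidPDE.HasUniformRapidDecayOn (Set.Icc (T - r ^ 2) (T - r ^ 2 / 2)) θ → (∀ t ∈ (Set.Icc (T - r ^ 2) (T - r ^ 2 / 2)), ∀ x : EuclideanSpace ℝ (Fin 3), Literature.Analysis.FluidPDE.timeDerivWithin (Set.Icc (T - r ^ 2) (T - r ^ 2 / 2)) θ t x + inner ℝ (u t x) (gradient (θ t) x) = Laplacian.laplacian (θ t) x) → Function.support (θ (T - r ^ 2)) ⊆ Metric.ball x₀ r → ∫ x, (θ (T - r ^ 2 / 2) x) ^ 2 ≤ δ ^ 2 * ∫ x, (θ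 (T - r ^ 2) x) ^ 2)) → False)) :=
  fun hS1 => ⟨cascadeRegime_of_coherentScaleExclusion,
    coherentScaleExclusion_of_sequentialTypeIExclusion_of_cascade hS1⟩

end Summit.NavierStokesRegularity.NavierStokesRegularity.Theorems
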